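import Literature.AlgebraicGeometry.ShimuraVarieties.UnitaryAuxiliaryComplexStructure
import HarnessLib

/-!
# The complex structure `J_{β,Φ}(z)` determines the point `z`: injectivity of the layers of the symplectic embedding
# ([Deligne 1979] Prop. 2.3.10 — bookkeeping for [Deligne 1971] Prop. 1.15)

Topic `AlgebraicGeometry/ShimuraVarieties`; namespace `Literature.AlgebraicGeometry.ShimuraVarieties.UnitaryCanonicalModel.Aux`.
Theorems only (no definition, no named fact, no instance, no `sorry`).  Continuation of ★ (g-b) `UnitaryAuxiliaryComplexStructure`.

* §1 injectivity of the algebraic layers of ★ `auxRep R β = conjRect ∘ resGL ∘ blockGL`: `blockGL_injective`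
  (`(t, X) ↦ diag(t, t·X)`), `resMatrix_injective` / `resGL_injective` (restriction of scalars along a basis, ★
  `Algebra.leftMulMatrix_injective`), `conjRect_injective` (change of frame), hence **`auxRep_injective`** — consumed by the
  rational-points lemma of the embedding (F-iii, `UnitaryAuxiliarySymplecticRationalPoints`) and by §2;
* §2 `exists_ringHom_comp_eq` (an embedding `ρ : M → ℂ` over `τ` along `j`, `ℂ` algebraically closed), the eigenline lemma
  `exists_eq_smul_of_reflJ_mulVec_eq_neg` (`r_w v = -v ⇒ v ∈ ℂw`), `reflJ_eq_conj_reflFrame`, `eq_of_reflJ_lift_eq`, and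
  **`auxComplexStructure_injective`**: under ★ `IsExtAdapted τ j Φ` the complex structure `J_{β,Φ}(z) = auxRep ℝ β (iPhi, s_z)`
  determines `z ∈ 𝔹²` — `auxRep` is injective, so `s_z = s_{z′}`; at an embedding `ρ ∈ Φ` over `τ` the `ρ`-component of `s_z` is
  the frame reflection `T r_{lift z} T⁻¹` (★ `sComp_of_eq`), and the `-1`-eigenline `ℂ·lift z` of `r_{lift z}` with `(lift z)₂ = 1`
  pins down `z`.

Cell hodgecm-mathlib, crux HDel (stmt-HodgeConjecture-24835), line F1ExtHodgeType v4.1, `stub_S2inj` (the infinite-level injectivity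
step of [Deligne 1971] 1.15 needs `x ↦ J_x` injective).  HC_CM is proved only modulo the 7 printed citations until rung 0 closes; this
file proves no cell binder.

## References
* [Deligne1979ShimuraVarieties] P. Deligne, *Variétés de Shimura* (1979), Prop. 2.3.10 (PDF p. 32 of Milne's translation).
* [Deligne1971TravauxShimura] P. Deligne, *Travaux de Shimura*, Sém. Bourbaki 389 (1971), 4.9 p. 148, Prop. 1.15 p. 132.
* [Milne2005ShimuraVarieties] J. S. Milne, *Introduction to Shimura varieties* (2005), §6 pp. 67–68.
-/

set_option autoImplicit false

noncomputable section

open Matrix NumberField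
open scoped TensorProduct

namespace Literature.AlgebraicGeometry.ShimuraVarieties

namespace UnitaryCanonicalModel

namespace Aux

open Literature.AlgebraicGeometry.ModuliOfAbelianVarieties
open Literature.AlgebraicGeometry.Motives (CMType)
open Literature.Geometry.ComplexHyperbolic

/-! ### §1. Injectivity of the algebraic layers of `auxRep` -/

section Injective

/-- `(t, X) ↦ diag(t, t·X)` is injective. [cite: Deligne1979ShimuraVarieties, Prop. 2.3.10 (PDF p. 32)] -/
theorem blockGL_injective (S : Type) [CommRing S] : Function.Injective (blockGL S) := by
  rintro ⟨t, X⟩ ⟨t', X'⟩ h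
  have hm := congrArg (fun u : GL (Fin 1 ⊕ Fin 3) S => (u : Matrix (Fin 1 ⊕ Fin 3) (Fin 1 ⊕ Fin 3) S)) h
  simp only [coe_blockGL] at hm
  have h11 := congrArg Matrix.toBlocks₁₁ hm
  have h22 := congrArg Matrix.toBlocks₂₂ hm
  simp only [Matrix.toBlocks_fromBlocks₁₁, Matrix.toBlocks_fromBlocks₂₂] at h11 h22
  have ht : (t : S) = (t' : S) := by
    have := congrFun (congrFun h11 0) 0
    simpa using this
  have htu : t = t' := Units.ext ht
  subst htu
  have hX : (X : Matrix (Fin 3) (Fin 3) S) = (X' : Matrix (Fin 3) (Fin 3) S) := by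
    have h2 := congrArg (fun A : Matrix (Fin 3) (Fin 3) S => ((t⁻¹ : Sˣ) : S) • A) h22
    simpa only [smul_smul, Units.inv_mul, one_smul] using h2
  rw [Units.ext hX]

variable {R S : Type} [CommRing R] [CommRing S] [Algebra R S]
variable {κ : Type} [Fintype κ] [DecidableEq κ] {m : Type} [Fintype m] [DecidableEq m]

/-- Restriction of scalars on matrices along a basis is injective. [cite: Deligne1971TravauxShimura, 4.9 p. 148] -/
theorem resMatrix_injective (b : Module.Basis κ R S) : Function.Injective (resMatrix (m := m) b) := by
  intro A B h
  have h' : (Matrix.compRingEquiv m κ R).symm (resMatrix b A) = (Matrix.compRingEquiv m κ R).symm (resMatrix b B) := by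
    rw [h]
  change (Matrix.compRingEquiv m κ R).symm ((Matrix.compRingEquiv m κ R) ((Algebra.leftMulMatrix b).toRingHom.mapMatrix A)) =
    (Matrix.compRingEquiv m κ R).symm ((Matrix.compRingEquiv m κ R) ((Algebra.leftMulMatrix b).toRingHom.mapMatrix B)) at h'
  rw [RingEquiv.symm_apply_apply, RingEquiv.symm_apply_apply] at h'
  exact Matrix.map_injective (Algebra.leftMulMatrix_injective b) h'

/-- Restriction of scalars on invertible matrices is injective. [cite: Deligne1971TravauxShimura, 4.9 p. 148] -/
theorem resGL_injective (b : Module.Basis κ R S) : Function.Injective (resGL (m := m) b) := fun A B h =>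
  Units.ext (resMatrix_injective b (by rw [← coe_resGL, ← coe_resGL, h]))

variable {n n' : Type} [Fintype n] [DecidableEq n] [Fintype n'] [DecidableEq n']

/-- Conjugation by a rectangular frame is injective. [cite: Milne2005ShimuraVarieties, §6 p. 67] -/
theorem conjRect_injective (P : Matrix n n' R) (Q : Matrix n' n R) (hPQ : P * Q = 1) (hQP : Q * P = 1) :
    Function.Injective (conjRect P Q hPQ hQP) := by
  intro g h hgh
  have hm := congrArg (fun u : GL n R => Q * (u : Matrix n n R) * P) hgh
  simp only [coe_conjRect] at hm
  have key : ∀ g : GL n' R, Q * (P * (g : Matrix n' n' R) * Q) * P = (g : Matrix n' n' R) := fun g => by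
    calc Q * (P * (g : Matrix n' n' R) * Q) * P = (Q * P) * (g : Matrix n' n' R) * (Q * P) := by
          simp only [Matrix.mul_assoc]
      _ = (g : Matrix n' n' R) := by rw [hQP, Matrix.one_mul, Matrix.mul_one]
  rw [key, key] at hm
  exact Units.ext hm

end Injective

section AuxRepInjective

variable {L : Type} [Field L] {M : Type} [Field M] [NumberField M] [IsCMField M] {j : L →+* M}
  {H : Matrix (Fin 3) (Fin 3) L} {ξ₀ ξ : M} {g : ℕ} {δ : Fin g → ℕ}

/-- **The similitude representation `auxRep R β` is injective** (composite of the three injective layers).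
[cite: Deligne1979ShimuraVarieties, Prop. 2.3.10 (PDF p. 32)] -/
theorem auxRep_injective (R : Type) [CommRing R] [Algebra ℚ R] (F : SymplecticFrame M j H ξ₀ ξ g δ) :
    Function.Injective (auxRep R F) :=
  (conjRect_injective (framePR R F) (frameQR R F) (framePR_mul_frameQR R F) (frameQR_mul_framePR R F)).comp
    ((resGL_injective (m := Fin 1 ⊕ Fin 3) (Algebra.TensorProduct.basis R (ratBasis M))).comp
      (blockGL_injective (R ⊗[ℚ] M)))

end AuxRepInjective

/-! ### §2. The complex structure determines the point of the ball -/

section Extend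

variable {L : Type} [Field L] [CharZero L] {M : Type} [Field M] [NumberField M]

/-- An embedding `τ : L → ℂ` extends along `j : L → M` to some `ρ : M → ℂ` (`ℂ` algebraically closed, `M/j(L)` algebraic) — the
non-empty fibre of the restriction map on complex embeddings over `τ` in which Deligne's partial CM type lives.
[cite: Deligne1979ShimuraVarieties, 2.3.9 (PDF p. 32 of Milne's translation)] [cite: Liu2021, App. C l. 4550 (the restriction map `π : Φ_E → Φ_F`)] -/
theorem exists_ringHom_comp_eq (j : L →+* M) (τ : L →+* ℂ) : ∃ ρ : M →+* ℂ, ρ.comp j = τ := by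
  letI : Algebra L M := j.toAlgebra
  letI : Algebra L ℂ := τ.toAlgebra
  haveI : IsScalarTower ℚ L M := IsScalarTower.of_algebraMap_eq (R := ℚ) (S := L) (A := M) fun q => by
    change algebraMap ℚ M q = j (algebraMap ℚ L q)
    rw [eq_ratCast (algebraMap ℚ L), map_ratCast, eq_ratCast]
  haveI : Algebra.IsAlgebraic L M := Algebra.IsAlgebraic.tower_top (K := ℚ) L
  refine ⟨(IsAlgClosed.lift : M →ₐ[L] ℂ).toRingHom, RingHom.ext fun x => ?_⟩
  exact (IsAlgClosed.lift : M →ₐ[L] ℂ).commutes x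

end Extend

section ComplexStructureInjective

variable {L : Type} [Field L] [CharZero L] {M : Type} [Field M] [NumberField M] [IsCMField M]
  {j : L →+* M} {H : Matrix (Fin 3) (Fin 3) L} {ξ₀ ξ : M} {g : ℕ} {δ : Fin g → ℕ}
  (F : SymplecticFrame M j H ξ₀ ξ g δ) (τ : L →+* ℂ) (Φ : CMType M) (T : GL (Fin 3) ℂ)

/-- `r_w·w = -w` (as in ★ `UnitaryAuxiliaryComplexStructureFrame.reflJ_mulVec_self`, re-derived to keep the imports light).
[cite: Deligne1979ShimuraVarieties, Prop. 2.3.10 (PDF p. 32)] -/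
private theorem reflJ_mulVec_self_aux {w : Fin 3 → ℂ} (hw : formJ w ≠ 0) : reflJ w *ᵥ w = -w := by
  rw [reflJ, Matrix.sub_mulVec, Matrix.one_mulVec, Matrix.smul_mulVec, projJ, Matrix.smul_mulVec,
    Matrix.vecMulVec_mulVec, ← Matrix.dotProduct_mulVec, op_smul_eq_smul]
  change w - (2 : ℂ) • ((formJ w)⁻¹ • (formJ w • w)) = -w
  rw [smul_smul (formJ w)⁻¹, inv_mul_cancel₀ hw, one_smul, two_smul]
  abel

/-- The `-1`-eigenvectors of the reflection `r_w` lie on the line `ℂw`: `r_w v = -v ⇒ v = c·w`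
(`r_w v = v - 2·((w̄ᵀJ v)/(w̄ᵀJ w))·w`). [cite: Deligne1979ShimuraVarieties, Prop. 2.3.10 (PDF p. 32)] -/
theorem exists_eq_smul_of_reflJ_mulVec_eq_neg {w v : Fin 3 → ℂ} (h : reflJ w *ᵥ v = -v) : ∃ c : ℂ, v = c • w := by
  set c : ℂ := (formJ w)⁻¹ * (star w ᵥ* BallModel.J ⬝ᵥ v) with hc
  have hP : projJ w *ᵥ v = c • w := by
    rw [projJ, Matrix.smul_mulVec, Matrix.vecMulVec_mulVec, op_smul_eq_smul, smul_smul]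
  have hr : reflJ w *ᵥ v = v - (2 : ℂ) • (c • w) := by
    rw [reflJ, Matrix.sub_mulVec, Matrix.one_mulVec, Matrix.smul_mulVec, hP]
  rw [hr] at h
  refine ⟨c, ?_⟩
  have h2 : (2 : ℂ) • v = (2 : ℂ) • (c • w) := by
    rw [two_smul]
    calc v + v = v - (2 : ℂ) • (c • w) + v + (2 : ℂ) • (c • w) := by abel
      _ = -v + v + (2 : ℂ) • (c • w) := by rw [h]
      _ = (2 : ℂ) • (c • w) := by abel
  exact smul_right_injective _ (two_ne_zero' ℂ) h2

variable {j : L →+* M} {H : Matrix (Fin 3) (Fin 3) L} {ξ₀ ξ : M} {g : ℕ} {δ : Fin g → ℕ}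
  (F : SymplecticFrame M j H ξ₀ ξ g δ) (τ : L →+* ℂ) (Φ : CMType M) (T : GL (Fin 3) ℂ)

/-- `r_w = T⁻¹·s·T` recovers the `J`-reflection from the frame reflection `s = T·r_w·T⁻¹`. [cite: Deligne1979ShimuraVarieties, Prop. 2.3.10 (PDF p. 32)] -/
theorem reflJ_eq_conj_reflFrame (w : Fin 3 → ℂ) :
    reflJ w = ((T⁻¹ : GL (Fin 3) ℂ) : Matrix (Fin 3) (Fin 3) ℂ) * reflFrame T w * (T : Matrix (Fin 3) (Fin 3) ℂ) := by
  rw [reflFrame]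
  calc reflJ w = (((T⁻¹ : GL (Fin 3) ℂ) : Matrix (Fin 3) (Fin 3) ℂ) * (T : Matrix (Fin 3) (Fin 3) ℂ)) * reflJ w *
        (((T⁻¹ : GL (Fin 3) ℂ) : Matrix (Fin 3) (Fin 3) ℂ) * (T : Matrix (Fin 3) (Fin 3) ℂ)) := by
          rw [← Units.val_mul, inv_mul_cancel, Units.val_one, Matrix.one_mul, Matrix.mul_one]
    _ = ((T⁻¹ : GL (Fin 3) ℂ) : Matrix (Fin 3) (Fin 3) ℂ) * ((T : Matrix (Fin 3) (Fin 3) ℂ) * reflJ w *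
        ((T⁻¹ : GL (Fin 3) ℂ) : Matrix (Fin 3) (Fin 3) ℂ)) * (T : Matrix (Fin 3) (Fin 3) ℂ) := by
          simp only [Matrix.mul_assoc]

/-- Two points of the ball with the same `J`-reflection coincide (the `-1`-eigenline of `r_{lift z}` is `ℂ·lift z` and
`(lift z)₂ = 1`). [cite: Deligne1979ShimuraVarieties, Prop. 2.3.10 (PDF p. 32)] -/
theorem eq_of_reflJ_lift_eq {z z' : BallModel.Ball} (h : reflJ (BallModel.lift z) = reflJ (BallModel.lift z')) : z = z' := by
  have hneg : reflJ (BallModel.lift z) *ᵥ BallModel.lift z' = -BallModel.lift z' := by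
    rw [h]; exact reflJ_mulVec_self_aux (formJ_lift_ne_zero z')
  obtain ⟨c, hc⟩ := exists_eq_smul_of_reflJ_mulVec_eq_neg hneg
  have hc1 : c = 1 := by
    simpa using (congrFun hc 2).symm
  rw [hc1, one_smul] at hc
  exact BallModel.Ball.ext fun i => by
    fin_cases i
    · have := congrFun hc 0; simpa using this.symm
    · have := congrFun hc 1; simpa using this.symm

/-- **The complex structure determines the point**: under `IsExtAdapted τ j Φ`, `J_{β,Φ}(z) = J_{β,Φ}(z′) ⇒ z = z′`
(`auxRep` is injective, so `s_z = s_{z′}`; at an embedding `ρ ∈ Φ` over `τ` — which exists and lies in `Φ` by adaptedness —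
the component is the frame reflection in the negative line of `z`, and that line determines `z`).
[cite: Deligne1979ShimuraVarieties, Prop. 2.3.10 (PDF p. 32)] [cite: Milne2005ShimuraVarieties, §6 p. 68] -/
theorem auxComplexStructure_injective (hΦ : IsExtAdapted τ j Φ) :
    Function.Injective (auxComplexStructure F τ Φ T) := by
  intro z z' h
  -- `s_z = s_{z'}`
  have hGL : auxComplexStructureGL F τ Φ T z = auxComplexStructureGL F τ Φ T z' := Units.ext h
  have hpair := auxRep_injective ℝ F hGL
  have hs : sMat M j Φ τ T (BallModel.lift z) = sMat M j Φ τ T (BallModel.lift z') := by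
    have := congrArg (fun u : GL (Fin 3) (ℝ ⊗[ℚ] M) => (u : Matrix (Fin 3) (Fin 3) (ℝ ⊗[ℚ] M))) (Prod.mk.inj hpair).2
    simpa only [coe_sPhi] using this
  -- the component at `ρ ∈ Φ` over `τ`
  obtain ⟨ρ, hρ⟩ := exists_ringHom_comp_eq j τ
  let ρ' : Φ.1 := ⟨ρ, hΦ ρ hρ⟩
  have hcomp : ρ'.1.comp j = τ := hρ
  have hrefl : reflFrame T (BallModel.lift z) = reflFrame T (BallModel.lift z') := by
    have := congrArg (fun A : Matrix (Fin 3) (Fin 3) (ℝ ⊗[ℚ] M) => A.map (realEmb M Φ ρ')) hs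
    simpa only [sMat_map_realEmb, sComp_of_eq _ hcomp] using this
  have hJ : reflJ (BallModel.lift z) = reflJ (BallModel.lift z') := by
    rw [reflJ_eq_conj_reflFrame T, reflJ_eq_conj_reflFrame T (BallModel.lift z'), hrefl]
  exact eq_of_reflJ_lift_eq hJ

end ComplexStructureInjective

end Aux

end UnitaryCanonicalModel

end Literature.AlgebraicGeometry.ShimuraVarieties

end
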